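import Mathlib
import Literature.Analysis.FluidPDE.VectorCalculus
import Literature.Analysis.FluidPDE.VorticityCalculus
import Literature.Analysis.FluidPDE.AxisymmetricEuler
import Literature.Analysis.FluidPDE.AxisymmetricVorticityTransport
import Literature.Analysis.FluidPDE.AxisymSwirlGradientCurl
import Literature.Analysis.FluidPDE.AxisymNoSwirlScaleInvariantBounds
import Literature.Analysis.FluidPDE.GavrilovSteadyEuler
import Literature.Analysis.FluidPDE.GavrilovSteadyEulerProofs
import Literature.Analysis.FluidPDE.KNSSAxisymmetricNoSwirlHolds
import Literature.Analysis.FluidPDE.AncientMildDrift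
import HarnessLib

/-!
# Silent shells — the multi-axis compacton attempt on W1 ⟨1222⟩ and its typed obstructions

Crux workfile sketch for `stmt-NavierStokesRegularity-1222`
(`Summit.NavierStokesRegularity.NavierStokesRegularity.Theses.ThreadingFlux.PoloidalLiouville`,
wall W1 = registered stub `stub_scalarLiouville`), ideator ns-idea-15 g8, lens «negation».
NOTHING HERE PROVES OR REFUTES THE CRUX, THE STUB, OR NS REGULARITY (which is NOT proved).

**v1.4 (custodian ns-idea-15 g9, 2026-08-29; critic V23 addendum #3 + ns-wall-eng-4):** I1 `SliceAnalytic` is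
FALSE AS TYPED (one-point modification of `0`; the mild class is a.e.-blind in `x`; class MISSTATED).  Added the
repaired fact I1′ `SliceAnalytic'` (the trigger's `ContDiffOn` binder inserted) and the reduction of record
`localAxisTrigger0_of_gauge' : SliceAnalytic' → GalileanAxisymmetryPropagates → LocalAxisTrigger0` (kernel; the
v1.3 proof verbatim); I1 and the v1.3 glue stay as the settled negative edge / its instance.  Nothing else changed.

## The attempted counterexample (inviscid, localized)

*Lever.* COMPACT SUPPORT ("silence") as a gluing device: two compactly supported `C¹` steady
Euler flows with disjoint supports superpose to a steady Euler flow (`isSteadyEulerC1_add`, proved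
below: outside `tsupport U₂` the sum is locally `U₁` and `∇P₂ = -(U₂·∇)U₂ = 0`). If SILENT
axisymmetric NO-SWIRL blocks existed, two of them about DIFFERENT axes through `x₀`, placed in
disjoint concentric shells, would give a compactly supported steady Euler flow UNTHREADED about `x₀`
(vorticity tangent to the spheres `S_r(x₀)`, `isUnthreadedAbout_add`) whose vorticity is not
coplanar (`multiAxisCompacton_of_blocks`) — i.e. the inviscid, localized analogue of W1's shape
conclusion and of W2's rigidity («unthreaded ⇒ axisymmetric no-swirl») would be FALSE.

## Why it dies (three typed obstructions)

* (O1) **Jiu–Xin Liouville** [JiuXin2008, Thm 5.3; quoted for compact support in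
  ConstantinLaVicol2019 p. 4 and DomínguezVázquez–Enciso–PeraltaSalas 2021 p. 3]: a `C¹` steady
  axisymmetric Euler flow WITHOUT swirl with finite energy and `u → 0`, `p → p₀` at infinity is
  trivial. Mechanism: test the momentum equation with the singular field `e_ρ/ρ = ∇log ρ`; with no
  swirl the quadratic form is `-u_ρ²/ρ²` (sign-definite) and the axis is a streamline on which
  Bernoulli gives `p - p₀ = -u_z²/2 ≤ 0`. Typed AS PRINTED (`jiuXin2008_thm53`: `L²`, decay,
  `p → p₀`) and the compact-support corollary `jiuXin_noSwirl_liouville` DERIVED by kernel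
  (`jiuXin_noSwirl_liouville_of_printed`: the pressure is constant outside a ball because
  `∇p = 0` off the support and the exterior of a ball in `ℝ³` is connected,
  `pressure_const_outside`). Hence `¬ SilentNoSwirlBlock` (`not_silentNoSwirlBlock`).
  All known compactons (Gavrilov 2019 = tree THEOREM `gavrilov_compact_steady_euler_holds`,
  CLV 2019, DVEPS 2021) carry swirl, hence are threaded about every point.
* (O2) **Silence is necessary** for ANY piecewise-axisymmetric multi-axis steady construction: in a
  gap between two blocks the flow is potential and harmonic-continues; invariance under two rotation
  groups with distinct axes through `x₀` forces `SO(3)`-equivariance, i.e. `v = f(r) x`, and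
  `div v = 0` + regularity at `x₀` force `v = 0` there (`TwoAxesTrivial`, statement).
* (O3) **NS analyticity forbids silent pieces**: a bounded ancient mild solution is real-analytic in
  `x` at every `t < 0`; local axisymmetry on an open set propagates globally
  (`isAxisymmetric_of_locallyAxisymmetric`, PROVED from the identity theorem), so two local axes
  through `x₀` at one time already force the slice to vanish (with (O2)).

## What survives: the open inviscid crux E0 and why JX's mechanism does not settle it

`UnthreadedCompactonTrivial` (E0): *every compactly supported `C¹` steady Euler flow threads
every point* (equivalently: no UNTHREADED Gavrilov flow). It implies (O1) (`jiuXin_of_E0`, since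
axisymmetric no-swirl ⇒ unthreaded about every axis point, `isUnthreadedAbout_axis_of_hasNoSwirl`,
PROVED from the tree's `curl_toroidal_of_hasNoSwirl`), kills the attempted counterexample
(`not_multiAxisCompacton_of_E0`) and says Gavrilov's flow is threaded about every point
(`gavrilov_threaded_of_E0`, using the tree THEOREM). JX's sign mechanism does NOT transfer from
«axis + pointwise no-swirl» to «point + poloidal»: the point-source analogue `∇(1/r)` of `∇log ρ`
yields the quadratic form `(‖v‖²‖x‖² - 3⟪v,x⟫²)/‖x‖⁵`, INDEFINITE on poloidal directions
(`pointSourceForm_indefinite`), and unthreadedness (tangential part of `v|_{S_r}` exact) is a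
NONLOCAL condition on each sphere, invisible to any pointwise quadratic form. So E0 is genuinely open
in both directions: a DVEPS-type overdetermined construction with sphere-foliated vortex lines would
refute it; a sphere-wise (pseudo-differential) JX identity would prove it. E0 is DECIDED in two
subclasses: axisymmetric compactons unthreaded about an axis point (no-swirl lemma I3 + JX,
`unthreadedCompactonTrivial_axisymmetric`) and Gavrilov-trick (localizable, analytic-in-bulk)
compactons, which are axisymmetric by [PeraltasalasSlobodeanu2026, Thm 1.1].

## NS side: the local-axis trigger (kernel-reduced to named facts + the tree's KNSS Thm 5.2)

`LocalAxisTrigger0`: in W1's class, ONE open patch of axisymmetry about an axis through the centre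
on ONE slice already forces `v` constant — from slice analyticity (I1), time propagation of
axisymmetry (I2), «axisymmetric + unthreaded about an axis point ⇒ no swirl» (I3), slice
div-freeness, and `knss_axisymmetric_no_swirl'_holds` (tree THEOREM), `localAxisTrigger0_of`
(PROVED composition). So a W1 counterexample is nowhere locally axisymmetric at any time.

**v1.2 (g8): I3 is PROVED in kernel** (`hasNoSwirl_of_isAxisymmetric_of_unthreaded`, `C¹` suffices,
no divergence-freeness: unthreadedness makes the swirl gradient RADIAL, `DΓ(y)h = ω₂(y)⟪y, h⟫`, by the
tree's `IsAxisymmetric.fderiv_swirl_apply_eq_curl`; so `Γ = r V_θ` is constant on spheres about the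
centre and vanishes at their poles), hence `noSwirlOfUnthreadedAxisymmetric_holds`, the trigger
reduction without I3 (`localAxisTrigger0_of'`: I1 + I2 + slice div-freeness + KNSS by name) and E0 in
the axisymmetric class from Jiu–Xin alone (`unthreadedCompactonTrivial_axisymmetric_C1`).

**v1.3 (g8, after critic V23): I2 `AxisymmetryPropagates` is FALSE AS TYPED** (parasitic gauge
solutions `u = b(t)` of the duality-form class; `axisymmetryPropagates_false_as_typed`, the critic's
witness re-run here), so `localAxisTrigger0_of` / `localAxisTrigger0_of'` are ex falso and VOID as
by-name reductions.  REPAIR in section `GaugeRepair`: I2″ `GalileanAxisymmetryPropagates`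
(gauge-covariant, fact-shaped M, leans on idea-14's HH-0⁺), the KERNEL axis-pinning dichotomy
`axisPinning_dichotomy` (axisymmetric `C¹` + vorticity tangent to spheres about `−a` ⇒ `a` on the axis
or irrotational), I3 at an axis point, and the KERNEL reduction `localAxisTrigger0_of_gauge :
SliceAnalytic → GalileanAxisymmetryPropagates → LocalAxisTrigger0` (no slice div-freeness needed).

0 sorry. References: Q. Jiu, Z. Xin, Comm. Math. Phys. 287 (2009) 323–350, Thm 5.3
[cite: JiuXin2008, Thm 5.3]; P. Constantin, J. La, V. Vicol, GAFA 29 (2019) 1773–1793, p. 4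
[cite: ConstantinLaVicol2019, §1]; A. V. Gavrilov, GAFA 29 (2019) 190–197 [cite: Gavrilov2019, §1];
M. Domínguez-Vázquez, A. Enciso, D. Peralta-Salas, ARMA 239 (2021), arXiv:2005.04380, p. 3;
D. Peralta-Salas, R. Slobodeanu, arXiv:2606.13462 (2026), Thm 1.1 (localizable ⇒ axisymmetric) [PeraltasalasSlobodeanu2026].
-/

noncomputable section

set_option linter.dupNamespace false

open Set Function Filter Topology MeasureTheory
open scoped RealInnerProductSpace

namespace Summit.NavierStokesRegularity.NavierStokesRegularity.Cruxes.PoloidalLiouville.SilentShells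

open Literature.Analysis.FluidPDE

local notation "ℝ³" => EuclideanSpace ℝ (Fin 3)

/-! ## §1 Vocabulary -/

/-- A `C¹` steady Euler flow on `ℝ³` in the tree's pointwise vocabulary (as in
`gavrilov_compact_steady_euler`): `U, P ∈ C¹`, `div U = 0`, `(U·∇)U + ∇P = 0`. -/
def IsSteadyEulerC1 (U : ℝ³ → ℝ³) (P : ℝ³ → ℝ) : Prop :=
  ContDiff ℝ 1 U ∧ ContDiff ℝ 1 P ∧ VectorCalculus.IsDivFree U ∧
    ∀ x, convect U U x + gradient P x = 0

/-- `U` is UNTHREADED about `x₀`: its vorticity is tangent to every sphere centred at `x₀`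
(the pointwise hypothesis of crux ⟨1222⟩ `PoloidalLiouville`, one time slice). -/
def IsUnthreadedAbout (x₀ : ℝ³) (U : ℝ³ → ℝ³) : Prop :=
  ∀ x, ⟪x - x₀, curl U x⟫ = 0

/-- The vorticity of `U` is COPLANAR: orthogonal to one fixed nonzero vector (as for an
axisymmetric no-swirl field, whose vorticity is azimuthal). -/
def HasCoplanarVorticity (U : ℝ³ → ℝ³) : Prop :=
  ∃ a : ℝ³, a ≠ 0 ∧ ∀ x, ⟪curl U x, a⟫ = 0

/-- **The negation target (inviscid, localized).** A compactly supported `C¹` steady Euler flow,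
unthreaded about some point, whose vorticity is NOT coplanar — in particular not axisymmetric
without swirl about any axis: the localized inviscid counterexample to the shape conclusion of W1 /
the rigidity of W2. OPEN; `not_multiAxisCompacton_of_E0` shows E0 forbids it. -/
def MultiAxisCompacton : Prop :=
  ∃ (U : ℝ³ → ℝ³) (P : ℝ³ → ℝ) (x₀ : ℝ³),
    IsSteadyEulerC1 U P ∧ HasCompactSupport U ∧ IsUnthreadedAbout x₀ U ∧ ¬ HasCoplanarVorticity U

/-! ## §2 The gluing lever (kernel-checked): disjointly supported steady flows superpose -/

theorem eventuallyEq_zero_of_notMem_tsupport {U : ℝ³ → ℝ³} {x : ℝ³} (hx : x ∉ tsupport U) :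
    U =ᶠ[𝓝 x] 0 := by
  filter_upwards [(isClosed_tsupport U).isOpen_compl.mem_nhds hx] with y hy
  by_contra h
  exact hy (subset_tsupport U (Function.mem_support.mpr h))

theorem add_eventuallyEq_left {U₁ U₂ : ℝ³ → ℝ³} {x : ℝ³} (hx : x ∉ tsupport U₂) :
    (U₁ + U₂) =ᶠ[𝓝 x] U₁ := by
  filter_upwards [eventuallyEq_zero_of_notMem_tsupport hx] with y hy
  simp [hy]

theorem add_eventuallyEq_right {U₁ U₂ : ℝ³ → ℝ³} {x : ℝ³} (hx : x ∉ tsupport U₁) :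
    (U₁ + U₂) =ᶠ[𝓝 x] U₂ := by
  filter_upwards [eventuallyEq_zero_of_notMem_tsupport hx] with y hy
  simp [hy]

/-- `curl` is local (the tree's `curl_congr_of_eventuallyEq`, re-proved to keep imports light). -/
theorem curl_congr_nhds {f g : ℝ³ → ℝ³} {x : ℝ³} (h : f =ᶠ[𝓝 x] g) : curl f x = curl g x := by
  rw [curl_eq_curlCLM, curl_eq_curlCLM, h.fderiv_eq]

theorem isDivFree_add {U₁ U₂ : ℝ³ → ℝ³} (hU₁ : ContDiff ℝ 1 U₁) (hU₂ : ContDiff ℝ 1 U₂)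
    (h₁ : VectorCalculus.IsDivFree U₁) (h₂ : VectorCalculus.IsDivFree U₂) :
    VectorCalculus.IsDivFree (U₁ + U₂) := by
  intro x
  have hd1 : DifferentiableAt ℝ U₁ x := (hU₁.differentiable one_ne_zero) x
  have hd2 : DifferentiableAt ℝ U₂ x := (hU₂.differentiable one_ne_zero) x
  have e1 := h₁ x
  have e2 := h₂ x
  unfold VectorCalculus.divergence at e1 e2 ⊢
  rw [fderiv_add hd1 hd2, ContinuousLinearMap.toLinearMap_add, map_add, e1, e2, add_zero]

/-- Off `tsupport U₂` the momentum equation of the sum is that of `U₁`. -/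
theorem steadyEuler_add_aux {U₁ U₂ : ℝ³ → ℝ³} {P₁ P₂ : ℝ³ → ℝ}
    (h₁ : IsSteadyEulerC1 U₁ P₁) (h₂ : IsSteadyEulerC1 U₂ P₂) {x : ℝ³} (hx : x ∉ tsupport U₂) :
    convect (U₁ + U₂) (U₁ + U₂) x + gradient (P₁ + P₂) x = 0 := by
  have h0 : U₂ =ᶠ[𝓝 x] 0 := eventuallyEq_zero_of_notMem_tsupport hx
  have hx0 : U₂ x = 0 := h0.eq_of_nhds
  have hP2 : gradient P₂ x = 0 := by
    have := h₂.2.2.2 x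
    simpa [convect, hx0] using this
  have hd1 : DifferentiableAt ℝ P₁ x := (h₁.2.1.differentiable one_ne_zero) x
  have hd2 : DifferentiableAt ℝ P₂ x := (h₂.2.1.differentiable one_ne_zero) x
  have hgrad : gradient (P₁ + P₂) x = gradient P₁ x + gradient P₂ x := by
    unfold gradient
    rw [fderiv_add hd1 hd2, map_add]
  rw [convect_apply, (add_eventuallyEq_left hx).fderiv_eq, hgrad, hP2, add_zero, Pi.add_apply,
    hx0, add_zero]
  simpa [convect] using h₁.2.2.2 x

/-- **Superposition of disjointly supported steady Euler flows** (the gluing lever). -/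
theorem isSteadyEulerC1_add {U₁ U₂ : ℝ³ → ℝ³} {P₁ P₂ : ℝ³ → ℝ}
    (h₁ : IsSteadyEulerC1 U₁ P₁) (h₂ : IsSteadyEulerC1 U₂ P₂)
    (hdisj : Disjoint (tsupport U₁) (tsupport U₂)) :
    IsSteadyEulerC1 (U₁ + U₂) (P₁ + P₂) := by
  refine ⟨h₁.1.add h₂.1, h₁.2.1.add h₂.2.1, isDivFree_add h₁.1 h₂.1 h₁.2.2.1 h₂.2.2.1,
    fun x => ?_⟩
  by_cases hx : x ∈ tsupport U₂
  · have hx' : x ∉ tsupport U₁ := fun h => Set.disjoint_left.mp hdisj h hx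
    have := steadyEuler_add_aux h₂ h₁ hx'
    rwa [add_comm U₂ U₁, add_comm P₂ P₁] at this
  · exact steadyEuler_add_aux h₁ h₂ hx

/-- Unthreadedness about a common centre is additive (curl is additive on `C¹` fields). -/
theorem isUnthreadedAbout_add {U₁ U₂ : ℝ³ → ℝ³} {x₀ : ℝ³} (hU₁ : ContDiff ℝ 1 U₁)
    (hU₂ : ContDiff ℝ 1 U₂) (h₁ : IsUnthreadedAbout x₀ U₁) (h₂ : IsUnthreadedAbout x₀ U₂) :
    IsUnthreadedAbout x₀ (U₁ + U₂) := by
  intro x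
  have hc : curl (U₁ + U₂) x = curl U₁ x + curl U₂ x := by
    have := curl_add ((hU₁.differentiable one_ne_zero) x) ((hU₂.differentiable one_ne_zero) x)
    simpa [Pi.add_def] using this
  rw [hc, inner_add_right, h₁ x, h₂ x, add_zero]

/-- Three vorticity samples with trivial common orthogonal complement rule out coplanarity. -/
theorem not_hasCoplanarVorticity_of_samples {U : ℝ³ → ℝ³} (x₁ x₂ x₃ : ℝ³)
    (h : ∀ a : ℝ³, ⟪curl U x₁, a⟫ = 0 → ⟪curl U x₂, a⟫ = 0 → ⟪curl U x₃, a⟫ = 0 → a = 0) :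
    ¬ HasCoplanarVorticity U := by
  rintro ⟨a, ha, hperp⟩
  exact ha (h a (hperp x₁) (hperp x₂) (hperp x₃))

/-- **The construction, kernel-checked modulo its blocks.** Two compactly supported `C¹` steady
Euler flows with disjoint supports, both unthreaded about `0`, with three vorticity samples (two of
block 1 off block 2, one of block 2 off block 1) spanning in the sense of a trivial common orthogonal
complement, give a `MultiAxisCompacton`. With silent axisymmetric no-swirl blocks about two distinct
axes through `0` the sample condition is automatic — but such blocks do not exist (§3). -/
theorem multiAxisCompacton_of_blocks {U₁ U₂ : ℝ³ → ℝ³} {P₁ P₂ : ℝ³ → ℝ} {x₁ x₂ x₃ : ℝ³}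
    (h₁ : IsSteadyEulerC1 U₁ P₁) (h₂ : IsSteadyEulerC1 U₂ P₂)
    (hc₁ : HasCompactSupport U₁) (hc₂ : HasCompactSupport U₂)
    (hdisj : Disjoint (tsupport U₁) (tsupport U₂))
    (hu₁ : IsUnthreadedAbout 0 U₁) (hu₂ : IsUnthreadedAbout 0 U₂)
    (hx₁ : x₁ ∉ tsupport U₂) (hx₂ : x₂ ∉ tsupport U₂) (hx₃ : x₃ ∉ tsupport U₁)
    (hspan : ∀ a : ℝ³, ⟪curl U₁ x₁, a⟫ = 0 → ⟪curl U₁ x₂, a⟫ = 0 → ⟪curl U₂ x₃, a⟫ = 0 →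
      a = 0) :
    MultiAxisCompacton := by
  refine ⟨U₁ + U₂, P₁ + P₂, 0, isSteadyEulerC1_add h₁ h₂ hdisj, hc₁.add hc₂,
    isUnthreadedAbout_add h₁.1 h₂.1 hu₁ hu₂, not_hasCoplanarVorticity_of_samples x₁ x₂ x₃ ?_⟩
  intro a ha₁ ha₂ ha₃
  rw [curl_congr_nhds (add_eventuallyEq_left hx₁)] at ha₁
  rw [curl_congr_nhds (add_eventuallyEq_left hx₂)] at ha₂
  rw [curl_congr_nhds (add_eventuallyEq_right hx₃)] at ha₃
  exact hspan a ha₁ ha₂ ha₃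

/-! ## §3 Obstruction (O1): silent no-swirl blocks do not exist (Jiu–Xin 2009) -/

/-- A SILENT NO-SWIRL BLOCK: a nonzero compactly supported `C¹` steady Euler flow, axisymmetric
(about the `x₂`-axis, tree convention) without swirl. -/
def SilentNoSwirlBlock : Prop :=
  ∃ (U : ℝ³ → ℝ³) (P : ℝ³ → ℝ),
    IsSteadyEulerC1 U P ∧ HasCompactSupport U ∧ U ≠ 0 ∧ IsAxisymmetric U ∧ HasNoSwirl U

/-- **Jiu–Xin's Liouville theorem, compact-support corollary** (Jiu–Xin, CMP 287 (2009), Thm 5.3: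
`u, p ∈ C¹(ℝ³)` exact solutions of the steady axisymmetric Euler system WITHOUT swirl with
`‖u‖_{L²} < ∞`, `|u| → 0`, `p → p₀` at infinity vanish identically; for compactly supported `u` all
three hypotheses hold, `∇p = -(u·∇)u` being compactly supported — the form quoted by
Constantin–La–Vicol 2019, p. 4, and DVEPS 2021, p. 3). Candidate NAMED FACT for
`Literature/Analysis/FluidPDE` (not yet in the tree: `lean search JiuXin|noSwirl.*compact` ∅).
[cite: JiuXin2008, Thm 5.3] -/
def jiuXin_noSwirl_liouville : Prop :=
  ∀ (U : ℝ³ → ℝ³) (P : ℝ³ → ℝ),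
    IsSteadyEulerC1 U P → HasCompactSupport U → IsAxisymmetric U → HasNoSwirl U → U = 0

/-- **Jiu–Xin 2009, Theorem 5.3 AS PRINTED** (CMP 287 (2009) 323–350, Thm 5.3, pp. 26–27 of
the preprint: "Suppose that `u, p ∈ C¹(ℝ³)` are exact solutions of 3D steady axisymmetric Euler
equations (1.2)-(1.3) [the system WITHOUT swirl, p. 2] satisfying `‖u‖_{L²(ℝ³)} ≤ C`, `|u| → 0`,
`p → p₀` as `r² + z² → ∞` … Then `u ≡ 0` and `p ≡ p₀`"). Rendered on `ℝ³`: a `C¹` steady Euler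
pair (`IsSteadyEulerC1`) that is axisymmetric with no swirl (then `p` is automatically
axisymmetric: `∇(p ∘ R_θ - p) = 0` and `= 0` on the axis), square-integrable, vanishing at
infinity, with `p → p₀` at infinity, has `u = 0`. [cite: JiuXin2008, Thm 5.3] -/
def jiuXin2008_thm53 : Prop :=
  ∀ (U : ℝ³ → ℝ³) (P : ℝ³ → ℝ), IsSteadyEulerC1 U P → IsAxisymmetric U → HasNoSwirl U →
    MemLp U 2 volume → Tendsto U (cocompact ℝ³) (𝓝 0) →
    (∃ p₀ : ℝ, Tendsto P (cocompact ℝ³) (𝓝 p₀)) → U = 0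

/-- The exterior of a closed ball in `ℝ³` is preconnected (image of `sphere × (ρ, ∞)`). -/
theorem isPreconnected_compl_closedBall_r3 {ρ : ℝ} (hρ : 0 ≤ ρ) :
    IsPreconnected (Metric.closedBall (0 : ℝ³) ρ)ᶜ := by
  have hE : 1 < Module.rank ℝ ℝ³ := by
    rw [← Module.finrank_eq_rank]
    norm_cast
    simp [finrank_euclideanSpace]
  have himage : (fun q : ℝ³ × ℝ => q.2 • q.1) '' (Metric.sphere (0 : ℝ³) 1 ×ˢ Ioi ρ) =
      (Metric.closedBall (0 : ℝ³) ρ)ᶜ := by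
    ext z
    rw [mem_compl_iff, Metric.mem_closedBall, dist_zero_right, not_le]
    constructor
    · rintro ⟨⟨y, t⟩, ⟨hy, ht⟩, rfl⟩
      rw [mem_sphere_zero_iff_norm] at hy
      change ρ < t at ht
      show ρ < ‖t • y‖
      rw [norm_smul, hy, mul_one, Real.norm_of_nonneg (hρ.trans ht.le)]
      exact ht
    · intro hz
      have hn : ‖z‖ ≠ 0 := (hρ.trans_lt hz).ne'
      refine ⟨(‖z‖⁻¹ • z, ‖z‖), ⟨?_, hz⟩, ?_⟩
      · show ‖z‖⁻¹ • z ∈ Metric.sphere (0 : ℝ³) 1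
        rw [mem_sphere_zero_iff_norm, norm_smul, norm_inv, norm_norm, inv_mul_cancel₀ hn]
      · show ‖z‖ • ‖z‖⁻¹ • z = z
        rw [smul_smul, mul_inv_cancel₀ hn, one_smul]
  rw [← himage]
  exact ((isPreconnected_sphere hE 0 1).prod isPreconnected_Ioi).image _
    (continuous_snd.smul continuous_fst).continuousOn

/-- For a steady Euler pair the pressure gradient vanishes wherever the velocity does. -/
theorem gradient_eq_zero_of_apply_eq_zero {U : ℝ³ → ℝ³} {P : ℝ³ → ℝ} (h : IsSteadyEulerC1 U P)
    {x : ℝ³} (hx : U x = 0) : gradient P x = 0 := by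
  have := h.2.2.2 x
  simpa [convect, hx] using this

/-- Outside a ball containing the support, the pressure of a compactly supported steady Euler
pair is constant. -/
theorem pressure_const_outside {U : ℝ³ → ℝ³} {P : ℝ³ → ℝ} (h : IsSteadyEulerC1 U P)
    (hc : HasCompactSupport U) :
    ∃ R : ℝ, 0 ≤ R ∧ tsupport U ⊆ Metric.closedBall 0 R ∧
      ∃ p₀ : ℝ, ∀ x ∈ (Metric.closedBall (0 : ℝ³) R)ᶜ, P x = p₀ := by
  obtain ⟨R, hR⟩ := (hc : IsCompact (tsupport U)).isBounded.subset_closedBall (0 : ℝ³)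
  refine ⟨max R 0, le_max_right _ _, hR.trans (Metric.closedBall_subset_closedBall (le_max_left _ _)),
    ?_⟩
  have hopen : IsOpen (Metric.closedBall (0 : ℝ³) (max R 0))ᶜ := Metric.isClosed_closedBall.isOpen_compl
  have hdiff : DifferentiableOn ℝ P (Metric.closedBall (0 : ℝ³) (max R 0))ᶜ :=
    (h.2.1.differentiable one_ne_zero).differentiableOn
  have hzero : (Metric.closedBall (0 : ℝ³) (max R 0))ᶜ.EqOn (fderiv ℝ P) 0 := by
    intro x hx
    have hxU : x ∉ tsupport U := fun hx' =>
      hx (Metric.closedBall_subset_closedBall (le_max_left _ _) (hR hx'))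
    have hUx : U x = 0 := image_eq_zero_of_notMem_tsupport hxU
    have hg : gradient P x = 0 := gradient_eq_zero_of_apply_eq_zero h hUx
    have : fderiv ℝ P x = (InnerProductSpace.toDual ℝ ℝ³) (gradient P x) := by
      simp [gradient]
    rw [Pi.zero_apply, this, hg, map_zero]
  exact hopen.exists_is_const_of_fderiv_eq_zero (isPreconnected_compl_closedBall_r3 (le_max_right _ _))
    hdiff hzero

/-- **The compact-support corollary from the printed theorem** (kernel): compact support supplies
`u ∈ L²`, `|u| → 0` and `p → p₀` (the pressure is constant outside a ball: `∇p = -(u·∇)u = 0`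
there and the exterior of a ball in `ℝ³` is connected). -/
theorem jiuXin_noSwirl_liouville_of_printed (h : jiuXin2008_thm53) : jiuXin_noSwirl_liouville := by
  intro U P hE hc hax hsw
  have hcont : Continuous U := hE.1.continuous
  refine h U P hE hax hsw (hcont.memLp_of_hasCompactSupport hc) (hc.is_zero_at_infty) ?_
  obtain ⟨R, hR0, -, p₀, hp⟩ := pressure_const_outside hE hc
  refine ⟨p₀, ?_⟩
  have hev : ∀ᶠ x in cocompact ℝ³, P x = p₀ :=
    mem_cocompact.2 ⟨Metric.closedBall 0 R, isCompact_closedBall 0 R, fun x hx => hp x hx⟩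
  exact (tendsto_const_nhds (x := p₀)).congr' (hev.mono fun x hx => hx.symm)

/-- (O1): under Jiu–Xin's theorem there is no silent no-swirl block, so the multi-axis gluing has
no building blocks in the `C¹` class. -/
theorem not_silentNoSwirlBlock (h : jiuXin_noSwirl_liouville) : ¬ SilentNoSwirlBlock := by
  rintro ⟨U, P, hE, hc, hne, hax, hsw⟩
  exact hne (h U P hE hc hax hsw)

/-! ## §4 Axisymmetric no-swirl ⇒ unthreaded about every point of the axis (kernel-checked) -/

/-- An axisymmetric swirl-free `C¹` field is unthreaded about every point `c • e_z` of its axis: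
its vorticity is azimuthal (tree: `curl_toroidal_of_hasNoSwirl`), hence orthogonal to `x - c e_z`. -/
theorem isUnthreadedAbout_axis_of_hasNoSwirl {U : ℝ³ → ℝ³} (hax : IsAxisymmetric U)
    (hsw : HasNoSwirl U) (hU : ContDiff ℝ 1 U) (c : ℝ) : IsUnthreadedAbout (c • eZ) U := by
  intro x
  obtain ⟨hh, h2⟩ := curl_toroidal_of_hasNoSwirl hax hsw hU x
  have key : ⟪x - c • eZ, curl U x⟫ =
      x 0 * curl U x 0 + x 1 * curl U x 1 + (x 2 - c) * curl U x 2 := by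
    simp only [PiLp.inner_apply, RCLike.inner_apply, conj_trivial, Fin.sum_univ_three,
      PiLp.sub_apply, PiLp.smul_apply, eZ, smul_eq_mul]
    simp
    ring
  rw [key, h2, hh]
  ring

/-! ## §5 The surviving open crux E0 and its consequences (kernel-checked implications) -/

/-- **E0 — unthreaded compactons are trivial** («every compactly supported `C¹` steady Euler flow
threads every point»; equivalently: no unthreaded Gavrilov flow). OPEN. Why it might fail: an
overdetermined (DVEPS-type) construction with vortex lines foliating concentric spheres; why it might
hold: Jiu–Xin (axisymmetric case), Enciso–Peralta-Salas 2026 (localizable ⇒ axisymmetric). -/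
def UnthreadedCompactonTrivial : Prop :=
  ∀ (U : ℝ³ → ℝ³) (P : ℝ³ → ℝ) (x₀ : ℝ³),
    IsSteadyEulerC1 U P → HasCompactSupport U → IsUnthreadedAbout x₀ U → U = 0

/-- E0 contains Jiu–Xin's compact-support Liouville theorem (axisymmetric no-swirl flows are
unthreaded about the origin, §4). -/
theorem jiuXin_of_E0 (h : UnthreadedCompactonTrivial) : jiuXin_noSwirl_liouville := by
  intro U P hE hc hax hsw
  have hu := isUnthreadedAbout_axis_of_hasNoSwirl hax hsw hE.1 0
  rw [zero_smul] at hu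
  exact h U P 0 hE hc hu

theorem eZ_ne_zero : (eZ : ℝ³) ≠ 0 := by
  intro h0
  have := congrArg (fun v : ℝ³ => v 2) h0
  simp [eZ] at this

/-- E0 kills the negation target: an unthreaded compacton vanishes, and the zero field has
coplanar vorticity. -/
theorem not_multiAxisCompacton_of_E0 (h : UnthreadedCompactonTrivial) : ¬ MultiAxisCompacton := by
  rintro ⟨U, P, x₀, hE, hc, hu, hnc⟩
  have hU : U = 0 := h U P x₀ hE hc hu
  subst hU
  exact hnc ⟨eZ, eZ_ne_zero, fun x => by simp⟩

/-- E0's positive content on a flow that EXISTS: Gavrilov's compactly supported steady Euler flow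
(tree THEOREM `gavrilov_compact_steady_euler_holds`) is threaded about EVERY point of space. -/
theorem gavrilov_threaded_of_E0 (h : UnthreadedCompactonTrivial) :
    ∃ (U : ℝ³ → ℝ³) (P : ℝ³ → ℝ), IsSteadyEulerC1 U P ∧ HasCompactSupport U ∧ U ≠ 0 ∧
      ∀ x₀ : ℝ³, ¬ IsUnthreadedAbout x₀ U := by
  obtain ⟨U, P, hU, hP, hUc, hU0, hdiv, hE⟩ :=
    gavrilov_compact_steady_euler.exists_ne_zero gavrilov_compact_steady_euler_holds
  have hU1 : ContDiff ℝ 1 U := hU.of_le (by exact_mod_cast le_top)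
  have hP1 : ContDiff ℝ 1 P := hP.of_le (by exact_mod_cast le_top)
  exact ⟨U, P, ⟨hU1, hP1, hdiv, hE⟩, hUc, hU0, fun x₀ hu => hU0 (h U P x₀ ⟨hU1, hP1, hdiv, hE⟩ hUc hu)⟩

/-! ## §6 Why Jiu–Xin's sign mechanism does not transfer to the poloidal class (token) -/

/-- The quadratic form produced by testing the momentum flux `v ⊗ v` against the point-source field
`∇(-1/‖x‖) = x/‖x‖³` (the point analogue of Jiu–Xin's `∇log ρ`): `‖x‖⁵ · vᵀ ∇²(-1/‖x‖) v =
‖v‖²‖x‖² - 3⟪v,x⟫²`. -/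
def pointSourceForm (v x : ℝ³) : ℝ := ‖v‖ ^ 2 * ‖x‖ ^ 2 - 3 * ⟪v, x⟫ ^ 2

/-- The point-source form is INDEFINITE (negative on radial, positive on tangential directions —
both occur in a poloidal field `v = T x + ∇φ`): no pointwise sign replaces Jiu–Xin's `-u_ρ²/ρ²`. -/
theorem pointSourceForm_indefinite :
    pointSourceForm eZ eZ < 0 ∧ 0 < pointSourceForm (EuclideanSpace.single 0 1) eZ := by
  have h1 : ‖(eZ : ℝ³)‖ = 1 := by simp [eZ]
  have h2 : ‖(EuclideanSpace.single 0 1 : ℝ³)‖ = 1 := by simp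
  have h3 : ⟪(eZ : ℝ³), eZ⟫ = 1 := by
    rw [real_inner_self_eq_norm_sq, h1]; norm_num
  have h4 : ⟪(EuclideanSpace.single 0 1 : ℝ³), eZ⟫ = 0 := by
    simp [eZ, EuclideanSpace.inner_single_left]
  refine ⟨?_, ?_⟩
  · simp only [pointSourceForm, h1, h3]; norm_num
  · simp only [pointSourceForm, h1, h2, h4]; norm_num

/-! ## §7 Obstructions (O2)/(O3) on the Navier–Stokes side -/

/-- **(O3) Local axisymmetry propagates for real-analytic fields** (identity theorem; a bounded
ancient mild NS solution is real-analytic in space at each `t < 0`): if an analytic `V` is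
axisymmetric on a nonempty open set, it is axisymmetric on `ℝ³`. PROVED. -/
theorem isAxisymmetric_of_locallyAxisymmetric {V : ℝ³ → ℝ³} (hV : AnalyticOnNhd ℝ V univ)
    {S : Set ℝ³} (hS : IsOpen S) (hne : S.Nonempty)
    (hloc : ∀ θ : ℝ, ∀ x ∈ S, V (rotZ θ x) = rotZ θ (V x)) : IsAxisymmetric V := by
  intro θ
  obtain ⟨z₀, hz₀⟩ := hne
  have hf : AnalyticOnNhd ℝ (fun x => V (rotZ θ x)) univ := by
    have e : (fun x => V (rotZ θ x)) = V ∘ (rotZL θ) := by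
      ext x; simp
    rw [e]
    exact hV.comp ((rotZL θ).analyticOnNhd _) (mapsTo_univ _ _)
  have hg : AnalyticOnNhd ℝ (fun x => rotZ θ (V x)) univ := by
    have e : (fun x => rotZ θ (V x)) = (rotZL θ) ∘ V := by
      ext x; simp
    rw [e]
    exact ((rotZL θ).analyticOnNhd _).comp hV (mapsTo_univ _ _)
  have heq : (fun x => V (rotZ θ x)) =ᶠ[𝓝 z₀] (fun x => rotZ θ (V x)) := by
    filter_upwards [hS.mem_nhds hz₀] with x hx using hloc θ x hx
  intro x
  exact hf.eqOn_of_preconnected_of_eventuallyEq hg isPreconnected_univ (mem_univ z₀) heq (mem_univ x)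

/-- **(O2) Two axes through one point force triviality** (statement): a `C¹` divergence-free field
axisymmetric about the `x₂`-axis AND about a second, distinct axis through `0` (written through a
linear isometry `R` with `R e_z ∦ e_z`) vanishes identically — the two rotation groups generate
`SO(3)`, an `SO(3)`-equivariant field is `f(‖x‖) x`, and `div = 0` with continuity at `0` gives
`f = 0`. This is why any multi-axis piecewise-axisymmetric steady construction needs SILENT blocks
(the potential flow in a gap continues harmonically and inherits both symmetries). Not proved here. -/
def TwoAxesTrivial : Prop :=
  ∀ (V : ℝ³ → ℝ³) (R : ℝ³ ≃ₗᵢ[ℝ] ℝ³), ContDiff ℝ 1 V → VectorCalculus.IsDivFree V →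
    IsAxisymmetric V → IsAxisymmetric (fun x => R.symm (V (R x))) →
    (∀ c : ℝ, R eZ ≠ c • eZ) → V = 0

/-- **(O3) typed for the crux class** (statement): in W1's class, a time slice that is locally
axisymmetric about two distinct axes through `x₀` on nonempty open sets is identically zero — the
NS flow admits no «silent pieces». Follows from spatial analyticity + the two results above. -/
def TwoLocalAxesRigidity : Prop :=
  ∀ (V : ℝ³ → ℝ³) (R : ℝ³ ≃ₗᵢ[ℝ] ℝ³) (S₁ S₂ : Set ℝ³), AnalyticOnNhd ℝ V univ →
    VectorCalculus.IsDivFree V → IsOpen S₁ → S₁.Nonempty → IsOpen S₂ → S₂.Nonempty →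
    (∀ θ : ℝ, ∀ x ∈ S₁, V (rotZ θ x) = rotZ θ (V x)) →
    (∀ θ : ℝ, ∀ x ∈ S₂, R.symm (V (R (rotZ θ x))) = rotZ θ (R.symm (V (R x)))) →
    (∀ c : ℝ, R eZ ≠ c • eZ) → V = 0

/-- (O3) from (O2) and the propagation theorem: the analytic bookkeeping is kernel-checked. -/
theorem twoLocalAxesRigidity_of_twoAxesTrivial (h : TwoAxesTrivial) : TwoLocalAxesRigidity := by
  intro V R S₁ S₂ hV hdiv hS₁ hne₁ hS₂ hne₂ h₁ h₂ hR
  have hax₁ : IsAxisymmetric V := isAxisymmetric_of_locallyAxisymmetric hV hS₁ hne₁ h₁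
  have hW : AnalyticOnNhd ℝ (fun x => R.symm (V (R x))) univ := by
    have e : (fun x => R.symm (V (R x))) =
        (R.symm.toLinearIsometry.toContinuousLinearMap) ∘ V ∘
          (R.toLinearIsometry.toContinuousLinearMap) := by
      ext x; simp
    rw [e]
    refine (ContinuousLinearMap.analyticOnNhd _ _).comp (hV.comp
      (ContinuousLinearMap.analyticOnNhd _ _) (mapsTo_univ _ _)) (mapsTo_univ _ _)
  have hax₂ : IsAxisymmetric (fun x => R.symm (V (R x))) :=
    isAxisymmetric_of_locallyAxisymmetric hW hS₂ hne₂ h₂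
  exact h V R hV.contDiff hdiv hax₁ hax₂ hR


/-! ## NS side: no silent pieces — the local-axis trigger

The gluing device needs SILENCE; for Navier–Stokes slices silence is impossible (analyticity), and
more: a single open patch of axisymmetry about an axis through the centre already decides W1.
`LocalAxisTrigger0` (centre `x₀ = 0`, axis `e_z` — WLOG by the Euclidean covariance of the class)
is reduced by kernel to three fact-shaped ingredients and the tree's PROVED KNSS Thm 5.2
(`knss_axisymmetric_no_swirl'_holds`). So a W1 counterexample is NOWHERE locally axisymmetric
about any axis through `x₀`, at any time: it is irreducibly non-axisymmetric, and no
"superposition of axisymmetric pieces" ansatz can produce it. -/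

/-- (I1, fact-shaped, [cite: LemarieRieusset2016, Thm 9.12] = tree fact
`Literature.Analysis.FluidPDE.lemarieRieusset2016_local_analyticity` after identification by
`oseenMild_essBounded_unique`) slices of a bounded ancient mild solution are real-analytic. -/
def SliceAnalytic : Prop :=
  ∀ v : ℝ → ℝ³ → ℝ³, IsBoundedAncientMildSolution 1 v →
    (∀ t < 0, AEStronglyMeasurable (v t) volume) → ∀ t < 0, AnalyticOnNhd ℝ (v t) univ

/-- (I1′, v1.4 — the REPAIRED I1; critic V23 addendum #3 / ns-wall-eng-4: I1 is FALSE AS TYPED, witness =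
one-point modification of `0` (`SilentShells.sliceAnalytic_false_as_typed`, the class is a.e.-blind in `x`);
class MISSTATED — missing regularity binder.)  I1′ = I1 with the trigger's joint-smoothness binder
`ContDiffOn ℝ ⊤ (uncurry v) (Iio 0 ×ˢ univ)` inserted: smooth bounded ancient mild solutions have real-analytic
slices — KNSS / [cite: LemarieRieusset2016, Thm 9.12] spatial analyticity, fact-shaped (M).  The one-point
witness is not jointly smooth, so it misses I1′.  I1 stays in the file as the settled negative edge. -/
def SliceAnalytic' : Prop :=
  ∀ v : ℝ → ℝ³ → ℝ³, IsBoundedAncientMildSolution 1 v →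
    (∀ t < 0, AEStronglyMeasurable (v t) volume) →
    ContDiffOn ℝ (⊤ : ℕ∞) (Function.uncurry v) (Set.Iio 0 ×ˢ Set.univ) →
    ∀ t < 0, AnalyticOnNhd ℝ (v t) univ

/-- I1 ⇒ I1′ (trivial weakening; recorded so that every v1.3 reduction from I1 transfers verbatim). -/
theorem sliceAnalytic'_of_sliceAnalytic (h : SliceAnalytic) : SliceAnalytic' :=
  fun v hv hmeas _ t ht => h v hv hmeas t ht

/-- (I2 — **FALSE AS TYPED**, see `axisymmetryPropagates_false_as_typed` (critic V23: parasitic gauge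
solutions); kept as a settled negative edge; repaired by I2″ `GalileanAxisymmetryPropagates`.)
Original intent: axisymmetry of ONE slice propagates to all slices: forward by uniqueness of
bounded mild solutions (`oseenMild_essBounded_unique`) and rotation covariance of the class
(`IsometryInvariance`), backward by TIME-analyticity ([cite: LemarieRieusset2016, Thm 9.12]:
`u` is analytic in `t` and `x`) and the one-variable identity theorem applied to
`t ↦ v t (R x) - R (v t x)`, which vanishes on `(t₁, 0)`. -/
def AxisymmetryPropagates : Prop :=
  ∀ v : ℝ → ℝ³ → ℝ³, IsBoundedAncientMildSolution 1 v →
    (∀ t < 0, AEStronglyMeasurable (v t) volume) →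
    (∃ t₁ < 0, IsAxisymmetric (v t₁)) → ∀ t < 0, IsAxisymmetric (v t)

/-- (I3, calculus, S — PROVED in kernel in v1.2 below: `noSwirlOfUnthreadedAxisymmetric_holds`, with
`C¹` and without divergence-freeness, via the radial swirl gradient) an axisymmetric `C²` field whose
vorticity is tangent to the spheres about a point OF THE AXIS has no swirl. Original proof on paper: `ω = curl V` is axisymmetric and divergence-free;
with the Stokes stream function `Ψ` of its poloidal part, `ρ ω_ρ + z ω_z = ρ⁻¹ (z ∂_ρ − ρ ∂_z) Ψ`,
so `Ψ` is constant on the meridional semicircles `ρ² + z² = r²`, hence `Ψ ≡ Ψ(axis) = 0`, the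
poloidal vorticity vanishes, `∂_z (ρ V_θ) = ∂_ρ (ρ V_θ) = 0`, and boundedness at the axis gives
`V_θ ≡ 0`. -/
def NoSwirlOfUnthreadedAxisymmetric : Prop :=
  ∀ V : ℝ³ → ℝ³, ContDiff ℝ 2 V → VectorCalculus.IsDivFree V → IsAxisymmetric V →
    IsUnthreadedAbout 0 V → HasNoSwirl V

/-- **LocalAxisTrigger0** (W1 with ONE extra hypothesis: some slice is axisymmetric about the
`e_z`-axis on some nonempty open set). -/
def LocalAxisTrigger0 : Prop :=
  ∀ v : ℝ → ℝ³ → ℝ³, IsBoundedAncientMildSolution 1 v →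
    (∀ t < 0, AEStronglyMeasurable (v t) volume) →
    ContDiffOn ℝ (⊤ : ℕ∞) (Function.uncurry v) (Set.Iio 0 ×ˢ Set.univ) →
    (∀ t < 0, ∀ x, ⟪x, curl (v t) x⟫ = 0) →
    (∃ t₁ < 0, ∃ S : Set ℝ³, IsOpen S ∧ S.Nonempty ∧
        ∀ θ : ℝ, ∀ x ∈ S, v t₁ (rotZ θ x) = rotZ θ (v t₁ x)) →
    ∀ t < 0, ∃ b : ℝ³, ∀ x, v t x = b

/-- Slices of a jointly smooth `v` are `C²`. -/
theorem slice_contDiff_two {v : ℝ → ℝ³ → ℝ³}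
    (hv : ContDiffOn ℝ (⊤ : ℕ∞) (Function.uncurry v) (Set.Iio 0 ×ˢ Set.univ)) {t : ℝ} (ht : t < 0) :
    ContDiff ℝ 2 (v t) := by
  have hg : ContDiff ℝ (⊤ : ℕ∞) (fun x : ℝ³ => ((t, x) : ℝ × ℝ³)) :=
    contDiff_const.prodMk contDiff_id
  have h : ContDiffOn ℝ (⊤ : ℕ∞) (Function.uncurry v ∘ fun x : ℝ³ => ((t, x) : ℝ × ℝ³)) univ :=
    hv.comp hg.contDiffOn (fun x _ => Set.mk_mem_prod ht (Set.mem_univ x))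
  have h' : ContDiff ℝ (⊤ : ℕ∞) (v t) := by
    rw [← contDiffOn_univ]
    exact h
  exact_mod_cast (contDiff_infty.1 h') 2

/-- Slices of a div-free ancient mild… no: we only need div-freeness of smooth slices, which the
mild class provides weakly; we take it from the tree's slice lemma if available, else as input.
Here: the KERNEL REDUCTION of the trigger to I1–I3 + KNSS (proved in tree) + slice div-freeness.
**VOID as a by-name reduction (v1.3): its hypothesis I2 is false as typed; superseded by
`localAxisTrigger0_of_gauge`.** -/
theorem localAxisTrigger0_of (h1 : SliceAnalytic) (h2 : AxisymmetryPropagates)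
    (h3 : NoSwirlOfUnthreadedAxisymmetric)
    (hdiv : ∀ v : ℝ → ℝ³ → ℝ³, IsBoundedAncientMildSolution 1 v →
      (∀ t < 0, AEStronglyMeasurable (v t) volume) →
      ContDiffOn ℝ (⊤ : ℕ∞) (Function.uncurry v) (Set.Iio 0 ×ˢ Set.univ) →
      ∀ t < 0, VectorCalculus.IsDivFree (v t)) :
    LocalAxisTrigger0 := by
  intro v hv hmeas hsm hunthr ⟨t₁, ht₁, S, hS, hne, hloc⟩ t ht
  -- (1) the symmetric slice is globally axisymmetric (analytic continuation, proved above)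
  have hax₁ : IsAxisymmetric (v t₁) :=
    isAxisymmetric_of_locallyAxisymmetric (h1 v hv hmeas t₁ ht₁) hS hne hloc
  -- (2) every slice is axisymmetric
  have hax : ∀ s < 0, IsAxisymmetric (v s) := h2 v hv hmeas ⟨t₁, ht₁, hax₁⟩
  -- (3) every slice is swirl-free
  have hsw : ∀ s < 0, HasNoSwirl (v s) := fun s hs =>
    h3 (v s) (slice_contDiff_two hsm hs) (hdiv v hv hmeas hsm s hs) (hax s hs)
      (fun x => by simpa using hunthr s hs x)
  -- (4) KNSS 2009 Thm 5.2 (PROVED in the tree): the slice is a.e. constant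
  obtain ⟨b, hb⟩ := knss_axisymmetric_no_swirl'_holds hv hmeas hax hsw t ht
  refine ⟨b, fun x => ?_⟩
  -- (5) a.e. = everywhere for the continuous slice
  have hcont : Continuous (v t) := (slice_contDiff_two hsm ht).continuous
  have heq : v t = fun _ => b :=
    (hcont.ae_eq_iff_eq volume continuous_const).1 hb
  exact congrFun heq x



/-! ## E0 in the axisymmetric class (decided) and in the Gavrilov-trick class (remark)

With the no-swirl lemma I3, E0 HOLDS for axisymmetric compactons unthreaded about a point of the
axis (Jiu–Xin); and by Peralta-Salas–Slobodeanu 2026 (arXiv:2606.13462, Thm 1.1: an analytic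
LOCALIZABLE steady Euler flow `u · ∇Π = 0` on a bounded domain, tangent to the boundary with
regular Bernoulli levels there, is axisymmetric) every compacton obtainable by Gavrilov's
localizability trick is axisymmetric — so an E0 counterexample must be a NON-LOCALIZABLE,
nowhere-axisymmetric compacton: no construction in print produces one (PS26 p. 3). -/

/-- E0, axisymmetric case (x₀ on the axis, WLOG `x₀ = 0`): from I3 and Jiu–Xin. -/
theorem unthreadedCompactonTrivial_axisymmetric (h3 : NoSwirlOfUnthreadedAxisymmetric)
    (hJX : jiuXin_noSwirl_liouville) {U : ℝ³ → ℝ³} {P : ℝ³ → ℝ}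
    (hE : IsSteadyEulerC1 U P) (hU2 : ContDiff ℝ 2 U) (hc : HasCompactSupport U)
    (hax : IsAxisymmetric U) (hun : IsUnthreadedAbout 0 U) : U = 0 :=
  hJX U P hE hc hax (h3 U hU2 hE.2.2.1 hax hun)


/-! ## v1.2 (g8): I3 PROVED — an axisymmetric `C¹` field unthreaded about a point of its axis has no swirl

KERNEL (no divergence-freeness, no `C²`): for an axisymmetric field `V`, the tree's Cartesian form of
Majda–Bertozzi (2.64), `IsAxisymmetric.fderiv_swirl_apply_eq_curl`
(`DΓ(y)h = ω₂(y)(y₀h₀ + y₁h₁) − (y₀ω₀(y) + y₁ω₁(y)) h₂`, `Γ = swirl V = y₀V₁ − y₁V₀ = r V_θ`), combined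
with unthreadedness `⟪y, ω(y)⟫ = 0`, gives the RADIAL SWIRL GRADIENT `DΓ(y)h = ω₂(y)⟪y, h⟫`. Hence `Γ`
is constant along every differentiable curve on a sphere `‖y‖ = c`; the radial projection of the chord
from an off-axis point `x` to the pole `‖x‖e₂` is such a curve, and `Γ` vanishes on the axis. So
`Γ ≡ 0`, i.e. `HasNoSwirl V`.  Consequences wired below: I3 `NoSwirlOfUnthreadedAxisymmetric` holds BY
PROOF; the trigger reduction and the axisymmetric case of E0 lose that hypothesis. -/

section NoSwirl

/-- RADIAL SWIRL GRADIENT: for an axisymmetric field differentiable at `y` whose vorticity at `y` is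
tangent to the sphere about `0` through `y`, `DΓ(y)h = ω₂(y) ⟪y, h⟫`. -/
theorem fderiv_swirl_eq_curl_two_mul_inner {V : ℝ³ → ℝ³} (hax : IsAxisymmetric V) {y : ℝ³}
    (hd : DifferentiableAt ℝ V y) (hun : ⟪y, curl V y⟫ = 0) (h : ℝ³) :
    fderiv ℝ (swirl V) y h = curl V y 2 * ⟪y, h⟫ := by
  rw [hax.fderiv_swirl_apply_eq_curl hd h]
  have h0 : y 0 * curl V y 0 + y 1 * curl V y 1 + y 2 * curl V y 2 = 0 := by
    have e : ⟪y, curl V y⟫ = y 0 * curl V y 0 + y 1 * curl V y 1 + y 2 * curl V y 2 := by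
      simp only [PiLp.inner_apply, Fin.sum_univ_three, RCLike.inner_apply, conj_trivial]
      ring
    rw [← e]
    exact hun
  have hyh : ⟪y, h⟫ = y 0 * h 0 + y 1 * h 1 + y 2 * h 2 := by
    simp only [PiLp.inner_apply, Fin.sum_univ_three, RCLike.inner_apply, conj_trivial]
    ring
  rw [hyh]
  linear_combination (-(h 2)) * h0

/-- **I3, PROVED (`C¹` suffices).** An axisymmetric differentiable field on `ℝ³` whose vorticity is
tangent to every sphere about the origin (a point OF THE AXIS) has no swirl. -/
theorem hasNoSwirl_of_isAxisymmetric_of_unthreaded {V : ℝ³ → ℝ³} (hax : IsAxisymmetric V)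
    (hd : Differentiable ℝ V) (hun : ∀ y, ⟪y, curl V y⟫ = 0) : HasNoSwirl V := by
  have hrad : ∀ y h, fderiv ℝ (swirl V) y h = curl V y 2 * ⟪y, h⟫ := fun y h =>
    fderiv_swirl_eq_curl_two_mul_inner hax (hd y) (hun y) h
  intro x
  by_cases hx : x 0 = 0 ∧ x 1 = 0
  · simp [swirl, hx.1, hx.2]
  have hx0 : x ≠ 0 := by
    rintro rfl
    exact hx ⟨rfl, rfl⟩
  have hnx : ‖x‖ ≠ 0 := norm_ne_zero_iff.mpr hx0
  have hcpos : 0 < ‖x‖ := norm_pos_iff.mpr hx0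
  -- the pole of the sphere through `x`, the chord from `x` to it, and its radial projection `γ`
  set p : ℝ³ := ‖x‖ • EuclideanSpace.single 2 (1 : ℝ) with hp
  set w : ℝ → ℝ³ := fun s => x + s • (p - x) with hw
  have hw_ne : ∀ s, w s ≠ 0 := by
    intro s hs
    have h0 := congrArg (fun v : ℝ³ => v 0) hs
    have h1 := congrArg (fun v : ℝ³ => v 1) hs
    have h2 := congrArg (fun v : ℝ³ => v 2) hs
    simp [hw, hp] at h0 h1 h2
    by_cases hs1 : s = 1
    · subst hs1
      have hc0 : ‖x‖ = 0 := by linear_combination h2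
      exact hnx hc0
    · have hs1' : (1 : ℝ) - s ≠ 0 := sub_ne_zero.mpr (Ne.symm hs1)
      apply hx
      refine ⟨?_, ?_⟩
      · have e0 : (1 - s) * x 0 = 0 := by linear_combination h0
        exact (mul_eq_zero.mp e0).resolve_left hs1'
      · have e1 : (1 - s) * x 1 = 0 := by linear_combination h1
        exact (mul_eq_zero.mp e1).resolve_left hs1'
  set γ : ℝ → ℝ³ := fun s => (‖x‖ * ‖w s‖⁻¹) • w s with hγ
  have hw_diff : ∀ s, HasDerivAt w (p - x) s := by
    intro s
    have h := ((hasDerivAt_id s).smul_const (p - x)).const_add x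
    simpa [hw] using h
  have hγ_diff : ∀ s, DifferentiableAt ℝ γ s := by
    intro s
    have hws : DifferentiableAt ℝ w s := (hw_diff s).differentiableAt
    have hn : DifferentiableAt ℝ (fun s => ‖w s‖) s := hws.norm ℝ (hw_ne s)
    exact ((hn.inv (norm_ne_zero_iff.mpr (hw_ne s))).const_mul ‖x‖).smul hws
  -- `γ` stays on the sphere of radius `‖x‖`
  have hγ_norm : ∀ s, ‖γ s‖ = ‖x‖ := by
    intro s
    show ‖(‖x‖ * ‖w s‖⁻¹) • w s‖ = ‖x‖
    rw [norm_smul, Real.norm_of_nonneg (mul_nonneg (norm_nonneg x) (inv_nonneg.mpr (norm_nonneg _))),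
      inv_mul_cancel_right₀ (norm_ne_zero_iff.mpr (hw_ne s))]
  -- hence `γ' ⊥ γ`
  have hγ_orth : ∀ s, ⟪γ s, deriv γ s⟫ = 0 := by
    intro s
    have h1 : HasDerivAt (fun s => ⟪γ s, γ s⟫) (⟪γ s, deriv γ s⟫ + ⟪deriv γ s, γ s⟫) s :=
      (hγ_diff s).hasDerivAt.inner ℝ (hγ_diff s).hasDerivAt
    have h2 : HasDerivAt (fun s => ⟪γ s, γ s⟫) 0 s := by
      have e : (fun s => ⟪γ s, γ s⟫) = fun _ => ‖x‖ ^ 2 := by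
        funext s
        rw [real_inner_self_eq_norm_sq, hγ_norm]
      rw [e]
      exact hasDerivAt_const s (‖x‖ ^ 2)
    have h12 := h1.unique h2
    rw [real_inner_comm (γ s) (deriv γ s)] at h12
    linarith
  -- the swirl is constant along `γ`
  have hΓ_diff : Differentiable ℝ (fun s => swirl V (γ s)) := fun s =>
    (differentiableAt_swirl (hd (γ s))).comp s (hγ_diff s)
  have hΓ_deriv : ∀ s, deriv (fun s => swirl V (γ s)) s = 0 := by
    intro s
    have hcomp : HasDerivAt (fun s => swirl V (γ s)) (fderiv ℝ (swirl V) (γ s) (deriv γ s)) s :=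
      (differentiableAt_swirl (hd (γ s))).hasFDerivAt.comp_hasDerivAt s (hγ_diff s).hasDerivAt
    rw [hcomp.deriv, hrad, hγ_orth, mul_zero]
  have hconst := is_const_of_deriv_eq_zero hΓ_diff hΓ_deriv 0 1
  -- endpoints: `γ 0 = x`, and `γ 1` lies on the axis, where the swirl vanishes
  have hw0 : w 0 = x := by simp [hw]
  have hw1 : w 1 = p := by simp [hw]
  have hγ0 : γ 0 = x := by
    show (‖x‖ * ‖w 0‖⁻¹) • w 0 = x
    rw [hw0, mul_inv_cancel₀ hnx, one_smul]
  have hγ1 : swirl V (γ 1) = 0 := by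
    show swirl V ((‖x‖ * ‖w 1‖⁻¹) • w 1) = 0
    rw [hw1]
    simp [swirl, hp]
  calc swirl V x = swirl V (γ 0) := by rw [hγ0]
    _ = swirl V (γ 1) := hconst
    _ = 0 := hγ1

/-- **I3 holds** (kernel; the `C²` and divergence-free hypotheses of the Prop are not used). -/
theorem noSwirlOfUnthreadedAxisymmetric_holds : NoSwirlOfUnthreadedAxisymmetric :=
  fun V hV _ hax hun =>
    hasNoSwirl_of_isAxisymmetric_of_unthreaded hax (hV.differentiable (by norm_num))
      (fun y => by simpa using hun y)

/-- (**VOID as a by-name reduction (v1.3)**: I2 is false as typed; see `localAxisTrigger0_of_gauge`.)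
The trigger reduction WITHOUT the I3 input (v1.2): `LocalAxisTrigger0` follows from I1
`SliceAnalytic`, I2 `AxisymmetryPropagates`, slice divergence-freeness and KNSS (tree theorem). -/
theorem localAxisTrigger0_of' (h1 : SliceAnalytic) (h2 : AxisymmetryPropagates)
    (hdiv : ∀ v : ℝ → ℝ³ → ℝ³, IsBoundedAncientMildSolution 1 v →
      (∀ t < 0, AEStronglyMeasurable (v t) volume) →
      ContDiffOn ℝ (⊤ : ℕ∞) (Function.uncurry v) (Set.Iio 0 ×ˢ Set.univ) →
      ∀ t < 0, VectorCalculus.IsDivFree (v t)) :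
    LocalAxisTrigger0 :=
  localAxisTrigger0_of h1 h2 noSwirlOfUnthreadedAxisymmetric_holds hdiv

/-- E0 in the axisymmetric class WITHOUT the I3 input (v1.2): an axisymmetric `C²` compacton
unthreaded about a point of its axis is trivial, given Jiu–Xin's no-swirl Liouville theorem. -/
theorem unthreadedCompactonTrivial_axisymmetric' (hJX : jiuXin_noSwirl_liouville)
    {U : ℝ³ → ℝ³} {P : ℝ³ → ℝ} (hE : IsSteadyEulerC1 U P) (hU2 : ContDiff ℝ 2 U)
    (hc : HasCompactSupport U) (hax : IsAxisymmetric U) (hun : IsUnthreadedAbout 0 U) : U = 0 :=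
  unthreadedCompactonTrivial_axisymmetric noSwirlOfUnthreadedAxisymmetric_holds hJX hE hU2 hc hax hun

/-- … and with `C¹` only (the regularity of `IsSteadyEulerC1` itself). -/
theorem unthreadedCompactonTrivial_axisymmetric_C1 (hJX : jiuXin_noSwirl_liouville)
    {U : ℝ³ → ℝ³} {P : ℝ³ → ℝ} (hE : IsSteadyEulerC1 U P)
    (hc : HasCompactSupport U) (hax : IsAxisymmetric U) (hun : IsUnthreadedAbout 0 U) : U = 0 :=
  hJX U P hE hc hax
    (hasNoSwirl_of_isAxisymmetric_of_unthreaded hax (hE.1.differentiable one_ne_zero)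
      (fun y => by simpa using hun y))

end NoSwirl

/-! ## v1.3 (g8, after critic V23): I2 is FALSE AS TYPED — gauge-covariant repair, axis pinning in kernel

Critic ns-wall-crit-1 g4 (V23, file `pub/ideators/ns-wall-crit-1/g4/V23-I2-counterexample.lean`): the
tree's duality-form class `IsBoundedAncientMildSolution` contains the PARASITIC spatially constant
solutions `u(t,x) = b(t)` (`isBoundedAncientMildSolution_timeConst`, KNSS 2009 §1): `b(−1) = 0` is
axisymmetric, `b(t) = eₓ` otherwise is not — so I2 `AxisymmetryPropagates` is false as typed
(`axisymmetryPropagates_false_as_typed` below, the critic's proof re-run here; V21-P1 shape: the Prop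
stays in the file as a settled negative edge) and the v1.0–v1.2 reductions `localAxisTrigger0_of`,
`localAxisTrigger0_of'` are ex falso (VOID as «by-name reductions»).  `LocalAxisTrigger0` itself survives
the witness (its conclusion is slicewise constancy, which is gauge-tolerant).

REPAIR (this section, kernel where marked):
* I2″ `GalileanAxisymmetryPropagates` (fact-shaped, M): one axisymmetric slice ⇒ after a time-dependent
  Galilean change of gauge `ṽ(t,x) = v(t, x + A(t)) − c(t)` THAT STAYS IN THE CLASS, every slice of `ṽ`
  is axisymmetric.  Forward: Oseen-gauge uniqueness (`oseenMild_essBounded_unique`) + rotation covariance;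
  backward: TIME-analyticity of the gauge-fixed mild profile (idea-14's open stub HH-0⁺
  `NSSpaceTimeAnalyticityModGauge`; Dong–Zhang-type time analyticity for bounded mild solutions) + the
  one-variable identity theorem.  The parasitic witness satisfies it (`A = 0`, `c = b`, `ṽ = 0`).
* Z `axisPinning_dichotomy` (KERNEL): an axisymmetric `C¹` field whose vorticity is tangent to the
  spheres about the point `−a` has `a` ON THE AXIS or is IRROTATIONAL (rotating the tangency condition
  gives `ω(y) ⊥ y + R_θ a` for all `θ`; three angles kill `ω₀, ω₁`, then `ω₂` off the plane
  `y₂ = −a₂`, and continuity closes).  This is the step that consumes unthreadedness about the FIXED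
  centre at every time (the critic's «Z-1b-type freezing»), here a pointwise-in-time linear-algebra fact.
* I3 at an axis point (KERNEL, from v1.2 by an axial translation):
  `hasNoSwirl_of_isAxisymmetric_of_unthreaded_axisPoint`.
* `localAxisTrigger0_of_gauge` (KERNEL): `LocalAxisTrigger0` ⇐ I1 `SliceAnalytic` + I2″ — and nothing
  else: slice divergence-freeness is no longer needed (I3 is `C¹`-only), I3/Z/O3 are proved here, KNSS′ is
  the tree theorem `knss_axisymmetric_no_swirl'_holds` applied to the gauge-fixed `ṽ`, and
  `v(t) = ṽ(t)(· − A(t)) + c(t)` is then constant slicewise. -/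

section GaugeRepair

/-- the unit vector `eₓ` (critic's witness). -/
def eX : ℝ³ := EuclideanSpace.single 0 1

@[simp] theorem eX_apply_zero : eX 0 = 1 := by simp [eX]
@[simp] theorem eX_apply_one : eX 1 = 0 := by simp [eX]

/-- the parasitic drift witness: `0` at `t = −1`, `eₓ` at every other time. -/
def parasiticDrift (t : ℝ) : ℝ³ := if t = -1 then 0 else eX

theorem norm_parasiticDrift_le (t : ℝ) : ‖parasiticDrift t‖ ≤ 1 := by
  unfold parasiticDrift
  split_ifs
  · simp
  · simp [eX]

/-- **I2 `AxisymmetryPropagates` is FALSE AS TYPED** (critic ns-wall-crit-1 g4, V23; proof = the critic's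
file `V23-I2-counterexample.lean`, re-run verbatim on the in-file Prop): the parasitic solution
`u(t,x) = b(t)`, `b(−1) = 0`, `b(t) = eₓ` otherwise, lies in the duality-form class
(`isBoundedAncientMildSolution_timeConst`), has an axisymmetric slice at `t = −1` and a
non-axisymmetric one at `t = −2` (`rotZ π eₓ = −eₓ`). Tightness entry of V21-P1 shape: any
propagation statement must be GAUGE-COVARIANT (I2″ below). -/
theorem axisymmetryPropagates_false_as_typed : ¬ AxisymmetryPropagates := by
  intro h
  have hB : IsBoundedAncientMildSolution 1 (fun t (_ : ℝ³) => parasiticDrift t) :=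
    isBoundedAncientMildSolution_timeConst (E := ℝ³) 1 ⟨1, fun t _ => norm_parasiticDrift_le t⟩
  have hm : ∀ t < (0 : ℝ), AEStronglyMeasurable ((fun t (_ : ℝ³) => parasiticDrift t) t) volume :=
    fun t _ => aestronglyMeasurable_const
  have h1 : ∃ t₁ < (0 : ℝ), IsAxisymmetric ((fun t (_ : ℝ³) => parasiticDrift t) t₁) := by
    refine ⟨-1, by norm_num, fun θ x => ?_⟩
    ext i
    fin_cases i <;> simp [parasiticDrift]
  have h2 := h _ hB hm h1 (-2) (by norm_num) Real.pi eX
  have h3 := congrArg (fun w : ℝ³ => w 0) h2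
  norm_num [parasiticDrift] at h3

/-- **I2″ (gauge-covariant repair of I2; fact-shaped, M — leans on Oseen-gauge uniqueness forward and on
space-time analyticity modulo gauge backward, idea-14's HH-0⁺).** One axisymmetric slice ⇒ after a
time-dependent Galilean change of gauge that stays in the class, every slice is axisymmetric.
PROVER NOTE (critic V23 addendum #2): in print this follows from the Oseen-gauge representation
(`oseen_gauge_of_aestronglyMeasurable`) + forward uniqueness in the gauge-fixed class
(`oseenMild_essBounded_unique`) + rotation covariance + closure of the gauge-fixed class under CONSTANT
Galilean boosts + time analyticity mod gauge (HH-0⁺).  SUBTLETY: the gauge constant `c(t₁)` of the Oseen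
representation need not be axial, so `w(t₁) = v(t₁)(· + A(t₁)) − c(t₁)` is not axisymmetric in general;
absorb its horizontal part `c⊥` by the constant boost `w₂(t,y) := w(t, y − A(t₁) − c⊥(t − t₁)) + c⊥` (then
`w₂(t₁) = v(t₁) − c∥` IS axisymmetric and `w₂` stays gauge-fixed, Riesz pressures being boost-invariant for
div-free fields) and take `A(t) := A_Oseen(t) − A(t₁) − c⊥(t − t₁)`, `c := c_Oseen − c⊥` — the `∃ A c` form
below accommodates exactly this. -/
def GalileanAxisymmetryPropagates : Prop :=
  ∀ v : ℝ → ℝ³ → ℝ³, IsBoundedAncientMildSolution 1 v →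
    (∀ t < 0, AEStronglyMeasurable (v t) volume) →
    ContDiffOn ℝ (⊤ : ℕ∞) (Function.uncurry v) (Set.Iio 0 ×ˢ Set.univ) →
    (∃ t₁ < 0, IsAxisymmetric (v t₁)) →
    ∃ A c : ℝ → ℝ³,
      IsBoundedAncientMildSolution 1 (fun t x => v t (x + A t) - c t) ∧
      (∀ t < 0, AEStronglyMeasurable (fun x => v t (x + A t) - c t) volume) ∧
      ∀ t < 0, IsAxisymmetric (fun x => v t (x + A t) - c t)

/-- `R_θ` preserves inner products. -/
theorem inner_rotZ_rotZ' (θ : ℝ) (u w : ℝ³) : ⟪rotZ θ u, rotZ θ w⟫ = ⟪u, w⟫ := by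
  rw [← rotZLIE_apply, ← rotZLIE_apply, LinearIsometryEquiv.inner_map_map]

/-- `R_θ (u + w) = R_θ u + R_θ w`. -/
theorem rotZ_add_vec' (θ : ℝ) (u w : ℝ³) : rotZ θ (u + w) = rotZ θ u + rotZ θ w := by
  rw [← rotZL_apply, map_add, rotZL_apply, rotZL_apply]

/-- `R_{−θ} R_θ = id`. -/
theorem rotZ_neg_rotZ' (θ : ℝ) (u : ℝ³) : rotZ (-θ) (rotZ θ u) = u := by
  rw [← rotZ_add, neg_add_cancel, rotZ_zero]

/-- The curl of a Galilean translate: `curl (V(· + a) − c) (y) = curl V (y + a)`. -/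
theorem curl_translate_sub_const (V : ℝ³ → ℝ³) (a c y : ℝ³) :
    curl (fun x => V (x + a) - c) y = curl V (y + a) := by
  simp only [curl, fderiv_sub_const, fderiv_comp_add_right]

/-- The curl of a translate: `curl (V(· + a)) (y) = curl V (y + a)`. -/
theorem curl_translate (V : ℝ³ → ℝ³) (a y : ℝ³) :
    curl (fun x => V (x + a)) y = curl V (y + a) := by
  simp only [curl, fderiv_comp_add_right]

/-- **Z — axis pinning (KERNEL).** If an axisymmetric `C¹` field has vorticity tangent to the spheres
about the point `−a`, then either `a` lies on the symmetry axis or the field is irrotational. -/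
theorem axisPinning_dichotomy {w : ℝ³ → ℝ³} (hax : IsAxisymmetric w) (hw : ContDiff ℝ 1 w) (a : ℝ³)
    (hun : ∀ y, ⟪y + a, curl w y⟫ = 0) : (a 0 = 0 ∧ a 1 = 0) ∨ ∀ y, curl w y = 0 := by
  by_cases ha : a 0 = 0 ∧ a 1 = 0
  · exact Or.inl ha
  refine Or.inr ?_
  have hd : Differentiable ℝ w := hw.differentiable one_ne_zero
  have hωax : IsAxisymmetric (curl w) := hax.curl hd
  -- rotated tangency: `ω(y) ⊥ y + R_θ a` for every `θ`
  have hrot : ∀ θ y, ⟪y + rotZ θ a, curl w y⟫ = 0 := by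
    intro θ y
    have h := hun (rotZ (-θ) y)
    rw [hωax (-θ) y] at h
    have e : rotZ (-θ) y + a = rotZ (-θ) (y + rotZ θ a) := by
      rw [rotZ_add_vec', rotZ_neg_rotZ']
    rwa [e, inner_rotZ_rotZ'] at h
  have hne : a 0 ^ 2 + a 1 ^ 2 ≠ 0 := by
    intro h0
    apply ha
    have h0' : a 0 ^ 2 = 0 ∧ a 1 ^ 2 = 0 := by
      constructor <;> nlinarith [sq_nonneg (a 0), sq_nonneg (a 1)]
    exact ⟨pow_eq_zero_iff (n := 2) two_ne_zero |>.1 h0'.1, pow_eq_zero_iff (n := 2) two_ne_zero |>.1 h0'.2⟩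
  -- the vorticity vanishes off the plane `y₂ = −a₂`
  have hoff : ∀ y, y 2 + a 2 ≠ 0 → curl w y = 0 := by
    intro y hy
    have e0 := hrot 0 y
    have eπ := hrot Real.pi y
    have eπ2 := hrot (Real.pi / 2) y
    rw [rotZ_zero] at e0
    simp only [PiLp.inner_apply, Fin.sum_univ_three, PiLp.add_apply, rotZ_apply_zero, rotZ_apply_one,
      rotZ_apply_two, Real.cos_pi, Real.sin_pi, Real.cos_pi_div_two, Real.sin_pi_div_two,
      RCLike.inner_apply, conj_trivial] at e0 eπ eπ2
    have h0 : curl w y 0 = 0 := by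
      have : (a 0 ^ 2 + a 1 ^ 2) * curl w y 0 = 0 := by
        linear_combination (a 0 / 2 + a 1 / 2) * e0 + (a 1 / 2 - a 0 / 2) * eπ - a 1 * eπ2
      exact (mul_eq_zero.mp this).resolve_left hne
    have h1 : curl w y 1 = 0 := by
      have : (a 0 ^ 2 + a 1 ^ 2) * curl w y 1 = 0 := by
        linear_combination (a 1 / 2 - a 0 / 2) * e0 + (-(a 1 / 2) - a 0 / 2) * eπ + a 0 * eπ2
      exact (mul_eq_zero.mp this).resolve_left hne
    have h2 : curl w y 2 = 0 := by
      have : (y 2 + a 2) * curl w y 2 = 0 := by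
        linear_combination e0 - (y 0 + a 0) * h0 - (y 1 + a 1) * h1
      exact (mul_eq_zero.mp this).resolve_left hy
    ext i
    fin_cases i
    · exact h0
    · exact h1
    · exact h2
  -- continuity closes the plane
  have hcont : Continuous (curl w) := continuous_curl hw
  intro y
  by_cases hy : y 2 + a 2 ≠ 0
  · exact hoff y hy
  push Not at hy
  set e2 : ℝ³ := EuclideanSpace.single 2 1 with he2
  have hpath : Continuous (fun s : ℝ => curl w (y + s • e2)) :=
    hcont.comp (continuous_const.add (continuous_id.smul continuous_const))
  have hlim : Tendsto (fun s : ℝ => curl w (y + s • e2)) (𝓝[≠] 0) (𝓝 (curl w y)) := by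
    have h := hpath.tendsto 0
    simp only [zero_smul, add_zero] at h
    exact h.mono_left nhdsWithin_le_nhds
  have hzero : ∀ s : ℝ, s ≠ 0 → curl w (y + s • e2) = 0 := by
    intro s hs
    apply hoff
    have : (y + s • e2) 2 + a 2 = s := by
      simp [he2]
      linarith
    rw [this]
    exact hs
  have hlim0 : Tendsto (fun s : ℝ => curl w (y + s • e2)) (𝓝[≠] 0) (𝓝 0) :=
    tendsto_const_nhds.congr' (eventually_nhdsWithin_of_forall fun s hs => (hzero s hs).symm)
  exact tendsto_nhds_unique hlim hlim0

/-- **I3 at a point of the axis (KERNEL, from v1.2 by an axial translation):** an axisymmetric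
differentiable field whose vorticity is tangent to the spheres about an axis point `−a` has no swirl. -/
theorem hasNoSwirl_of_isAxisymmetric_of_unthreaded_axisPoint {V : ℝ³ → ℝ³} (hax : IsAxisymmetric V)
    (hd : Differentiable ℝ V) {a : ℝ³} (ha : a 0 = 0 ∧ a 1 = 0)
    (hun : ∀ y, ⟪y + a, curl V y⟫ = 0) : HasNoSwirl V := by
  -- translate the centre `−a` to the origin along the axis
  set W : ℝ³ → ℝ³ := fun y => V (y + -a) with hW
  have hfix : ∀ θ, rotZ θ (-a) = -a := fun θ =>
    rotZ_eq_self_of_axis θ (by simp [ha.1]) (by simp [ha.2])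
  have hWax : IsAxisymmetric W := by
    intro θ y
    simp only [hW]
    rw [← hax θ (y + -a), rotZ_add_vec', hfix]
  have hWd : Differentiable ℝ W := hd.comp (differentiable_id.add (differentiable_const _))
  have hWun : ∀ y, ⟪y, curl W y⟫ = 0 := by
    intro y
    rw [hW, curl_translate]
    simpa using hun (y + -a)
  have hWsw : HasNoSwirl W := hasNoSwirl_of_isAxisymmetric_of_unthreaded hWax hWd hWun
  intro x
  have h := hWsw (x + a)
  simp only [swirl, hW, add_neg_cancel_right, PiLp.add_apply, ha.1, ha.2, add_zero] at h
  simpa [swirl] using h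

/-- **The repaired trigger reduction (KERNEL): `LocalAxisTrigger0` ⇐ I1 `SliceAnalytic` + I2″
`GalileanAxisymmetryPropagates`** — with O3 (analytic continuation), Z (axis pinning), I3 (no swirl)
proved in this file and KNSS′ (`knss_axisymmetric_no_swirl'_holds`) from the tree, applied to the
gauge-fixed solution `ṽ`. No slice divergence-freeness is needed any more. -/
theorem localAxisTrigger0_of_gauge (h1 : SliceAnalytic) (h2 : GalileanAxisymmetryPropagates) :
    LocalAxisTrigger0 := by
  intro v hv hmeas hsm hunthr ⟨t₁, ht₁, S, hS, hne, hloc⟩ t ht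
  -- (1) the locally symmetric slice is globally axisymmetric (O3, analytic continuation)
  have hax₁ : IsAxisymmetric (v t₁) :=
    isAxisymmetric_of_locallyAxisymmetric (h1 v hv hmeas t₁ ht₁) hS hne hloc
  -- (2) gauge-fix: every slice of `ṽ` is axisymmetric (I2″)
  obtain ⟨A, c, hgv, hgmeas, hgax⟩ := h2 v hv hmeas hsm ⟨t₁, ht₁, hax₁⟩
  -- slices of `ṽ` are `C¹`
  have hgC1 : ∀ s < 0, ContDiff ℝ 1 (fun x => v s (x + A s) - c s) := fun s hs =>
    (((slice_contDiff_two hsm hs).of_le (by norm_num)).comp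
      (contDiff_id.add contDiff_const)).sub contDiff_const
  -- (3) tangency of `curl ṽ(s)` to the spheres about `−A(s)` (unthreadedness of `v` about `0`)
  have htan : ∀ s < 0, ∀ y, ⟪y + A s, curl (fun x => v s (x + A s) - c s) y⟫ = 0 := by
    intro s hs y
    rw [curl_translate_sub_const]
    exact hunthr s hs (y + A s)
  -- (4) every slice of `ṽ` is swirl-free: axis pinning (Z) + I3
  have hsw : ∀ s < 0, HasNoSwirl (fun x => v s (x + A s) - c s) := by
    intro s hs
    rcases axisPinning_dichotomy (hgax s hs) (hgC1 s hs) (A s) (htan s hs) with hA | hzero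
    · exact hasNoSwirl_of_isAxisymmetric_of_unthreaded_axisPoint (hgax s hs)
        ((hgC1 s hs).differentiable one_ne_zero) hA (htan s hs)
    · exact hasNoSwirl_of_isAxisymmetric_of_unthreaded (hgax s hs)
        ((hgC1 s hs).differentiable one_ne_zero) (fun y => by rw [hzero y, inner_zero_right])
  -- (5) KNSS 2009 Thm 5.2 (tree) on `ṽ`: the slice is a.e. constant, hence constant
  obtain ⟨b, hb⟩ := knss_axisymmetric_no_swirl'_holds hgv hgmeas hgax hsw t ht
  have hcont : Continuous (fun x => v t (x + A t) - c t) := (hgC1 t ht).continuous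
  have heq : (fun x => v t (x + A t) - c t) = fun _ => b :=
    (hcont.ae_eq_iff_eq volume continuous_const).1 hb
  refine ⟨b + c t, fun x => ?_⟩
  have hx := congrFun heq (x - A t)
  simp only [sub_add_cancel] at hx
  rw [← hx, sub_add_cancel]

/-- **v1.4 — the reduction OF RECORD (KERNEL): `LocalAxisTrigger0` ⇐ I1′ `SliceAnalytic'` + I2″
`GalileanAxisymmetryPropagates`** (critic V23 addendum #3: I1 is false as typed; the trigger carries the
`ContDiffOn` binder, so the v1.3 proof transfers verbatim with `h1 v hv hmeas hsm t₁ ht₁`).  O3, Z, I3 proved in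
this file; KNSS′ from the tree. -/
theorem localAxisTrigger0_of_gauge' (h1 : SliceAnalytic') (h2 : GalileanAxisymmetryPropagates) :
    LocalAxisTrigger0 := by
  intro v hv hmeas hsm hunthr ⟨t₁, ht₁, S, hS, hne, hloc⟩ t ht
  have hax₁ : IsAxisymmetric (v t₁) :=
    isAxisymmetric_of_locallyAxisymmetric (h1 v hv hmeas hsm t₁ ht₁) hS hne hloc
  obtain ⟨A, c, hgv, hgmeas, hgax⟩ := h2 v hv hmeas hsm ⟨t₁, ht₁, hax₁⟩
  have hgC1 : ∀ s < 0, ContDiff ℝ 1 (fun x => v s (x + A s) - c s) := fun s hs =>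
    (((slice_contDiff_two hsm hs).of_le (by norm_num)).comp
      (contDiff_id.add contDiff_const)).sub contDiff_const
  have htan : ∀ s < 0, ∀ y, ⟪y + A s, curl (fun x => v s (x + A s) - c s) y⟫ = 0 := by
    intro s hs y
    rw [curl_translate_sub_const]
    exact hunthr s hs (y + A s)
  have hsw : ∀ s < 0, HasNoSwirl (fun x => v s (x + A s) - c s) := by
    intro s hs
    rcases axisPinning_dichotomy (hgax s hs) (hgC1 s hs) (A s) (htan s hs) with hA | hzero
    · exact hasNoSwirl_of_isAxisymmetric_of_unthreaded_axisPoint (hgax s hs)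
        ((hgC1 s hs).differentiable one_ne_zero) hA (htan s hs)
    · exact hasNoSwirl_of_isAxisymmetric_of_unthreaded (hgax s hs)
        ((hgC1 s hs).differentiable one_ne_zero) (fun y => by rw [hzero y, inner_zero_right])
  obtain ⟨b, hb⟩ := knss_axisymmetric_no_swirl'_holds hgv hgmeas hgax hsw t ht
  have hcont : Continuous (fun x => v t (x + A t) - c t) := (hgC1 t ht).continuous
  have heq : (fun x => v t (x + A t) - c t) = fun _ => b :=
    (hcont.ae_eq_iff_eq volume continuous_const).1 hb
  refine ⟨b + c t, fun x => ?_⟩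
  have hx := congrFun heq (x - A t)
  simp only [sub_add_cancel] at hx
  rw [← hx, sub_add_cancel]

/-- The v1.3 glue is the I1-instance of the v1.4 glue. -/
theorem localAxisTrigger0_of_gauge_eq_of' (h1 : SliceAnalytic) (h2 : GalileanAxisymmetryPropagates) :
    LocalAxisTrigger0 :=
  localAxisTrigger0_of_gauge' (sliceAnalytic'_of_sliceAnalytic h1) h2

end GaugeRepair

end Summit.NavierStokesRegularity.NavierStokesRegularity.Cruxes.PoloidalLiouville.SilentShells
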